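import Mathlib
import Summits.ValiantsHypothesis.ValiantsHypothesis.Theses.RigidityForcesSymmetry
import Summits.ValiantsHypothesis.ValiantsHypothesis.Theorems.RigidityForcesSymmetryRankRigidMinimalReprLaplaceFourOptimal

/-!
# The frontier rung `TiedTorusBoundFour` (stmt-24814) from `LaplaceOptimalFive` (stmt-24813) — kernel transfer
# (crux `RankRigidMinimalRepr`, stmt-ValiantsHypothesis-18034, route `RigidityForcesSymmetry`)

The route file's two frontier support items of the tied-torus ladder are, definitionally (`Iff.rfl`),
`LaplaceOptimalFive ≝ LaplaceOptimal 5` and `TiedTorusBoundFour ≝ TiedTorusBound 4` (the route file inlines the bodies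
because it cannot import `Theorems/`).  This file lands the TRANSFER between them by name:

* `tiedTorusBound_four_of_laplaceOptimal_five : LaplaceOptimal 5 → TiedTorusBound 4` — for `m ≥ 5` the engine
  `grenetBound_of_laplaceOptimal (k := 4)`; for `m ∈ {3, 4}` every column index is `≤ 4`, so the torus with the first
  five column scalars tied IS the all-tied torus `tiedTorus m (m-1)` and the landed `laplaceOptimal_three` /
  `laplaceOptimal_four` apply through `tiedTorus_sub_one_le`;
* `TiedTorusBoundFour_of_LaplaceOptimalFive : …Theses.RigidityForcesSymmetry.LaplaceOptimalFive →
  …Theses.RigidityForcesSymmetry.TiedTorusBoundFour` — the same with both sides the ROUTE DECLS by name, plus the two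
  `Iff.rfl` bridges `laplaceOptimalFive_iff` / `tiedTorusBoundFour_iff`.

HONEST FRAMING: a conditional transfer between two OPEN support items (rank 9, frontier) of one route; it proves neither.
`LaplaceOptimal 5` is a finite tensor statement whose truth is open here (`LaplaceOptimal 4` is border-false and was
proved exactly by a 27-file case analysis); the crux `RankRigidMinimalRepr` stays OPEN; `VP ≠ VNP` is NOT proved and
nothing here bears on it.
-/

set_option autoImplicit false

-- the mandated summit-side namespace repeats a component by design (single-problem summit)
set_option linter.dupNamespace false

open Literature.Computability.AlgebraicComplexity
open Summit.ValiantsHypothesis.ValiantsHypothesis.Theorems.RigidityForcesSymmetryPairTiedTorusBound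

namespace Summit.ValiantsHypothesis.ValiantsHypothesis.Theorems.RigidityForcesSymmetryRankRigidMinimalRepr

/-- The route item `LaplaceOptimalFive` (stmt-24813) is by definition `LaplaceOptimal 5`. -/
theorem laplaceOptimalFive_iff :
    Summit.ValiantsHypothesis.ValiantsHypothesis.Theses.RigidityForcesSymmetry.LaplaceOptimalFive ↔
      LaplaceOptimal 5 :=
  Iff.rfl

/-- The route item `TiedTorusBoundFour` (stmt-24814) is by definition `TiedTorusBound 4`. -/
theorem tiedTorusBoundFour_iff :
    Summit.ValiantsHypothesis.ValiantsHypothesis.Theses.RigidityForcesSymmetry.TiedTorusBoundFour ↔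
      TiedTorusBound 4 :=
  Iff.rfl

/-- **Transfer `LaplaceOptimal 5 → TiedTorusBound 4`.**  For `m ≥ 5` this is the level-count engine
`grenetBound_of_laplaceOptimal (k := 4)`; for `m = 3, 4` the first five column scalars are all the column scalars, so
`tiedTorus m 4`-equivariance is `tiedTorus m (m-1)`-equivariance (`tiedTorus_sub_one_le m 4`) and the landed
`laplaceOptimal_three` / `laplaceOptimal_four` give the bound. -/
theorem tiedTorusBound_four_of_laplaceOptimal_five (hL : LaplaceOptimal 5) : TiedTorusBound 4 := by
  intro m hm n A hA
  by_cases h5 : 5 ≤ m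
  · exact grenetBound_of_laplaceOptimal hL m hm h5 n A hA
  · rcases (show m = 3 ∨ m = 4 by omega) with rfl | rfl
    · exact grenetBound_of_laplaceOptimal (k := 2) laplaceOptimal_three 3 hm le_rfl n A
        (hA.anti (tiedTorus_sub_one_le 3 4))
    · exact grenetBound_of_laplaceOptimal (k := 3) laplaceOptimal_four 4 hm le_rfl n A
        (hA.anti (tiedTorus_sub_one_le 4 4))

/-- **The frontier rung transfer with both sides the route decls by name**:
`LaplaceOptimalFive → TiedTorusBoundFour` (stmt-24813 → stmt-24814).  Conditional; proves neither item. -/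
theorem TiedTorusBoundFour_of_LaplaceOptimalFive :
    Summit.ValiantsHypothesis.ValiantsHypothesis.Theses.RigidityForcesSymmetry.LaplaceOptimalFive →
      Summit.ValiantsHypothesis.ValiantsHypothesis.Theses.RigidityForcesSymmetry.TiedTorusBoundFour :=
  fun h => tiedTorusBoundFour_iff.2 (tiedTorusBound_four_of_laplaceOptimal_five (laplaceOptimalFive_iff.1 h))

end Summit.ValiantsHypothesis.ValiantsHypothesis.Theorems.RigidityForcesSymmetryRankRigidMinimalRepr
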